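import Mathlib
import Summits.Ventures.PercRepro0.Defs
import Summits.Ventures.PercRepro0.Independence

/-!
# P7 · HARRIS–FKG, part 1: patterns on a finite coordinate set, atoms, sections and the
decomposition over the atoms (seat p3; Lemma 7.4 of proofs/P7-fkg-p3-v1.md)

Objects on `Set ι` (configurations = sets of open bonds), for a finite coordinate set `J : Finset ι`
and a pattern `η : J → Bool`:

* `onSet J η` — the coordinates of `J` switched on by `η`; `cyl J η` — the atom of `F_J` prescribed
  by `η`; `patch J η ω` — `ω` with its `J`-coordinates replaced by `η`; `sect J η D` — the section
  `{ω | patch J η ω ∈ D}` of an event `D` (depends only on the coordinates outside `J`);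
* `measurableSet_cyl` / `measurableSet_sect` — the atom is `F_J`-measurable, the section is
  `F_{Jᶜ}`-measurable (`Independence.sigmaOn`);
* `wt J p η = Π_{e ∈ J} p^{η e}(1 − p)^{1 − η e}` — the product weight; `setBernoulli_cyl`:
  `P(cyl J η) = wt J p η` for `J ⊆ u` (Mathlib's `infinitePi_pi` through `setBernoulli_apply'`);
* `real_eq_sum_sect` — Lemma 7.4(b) for indicators: `P(D) = Σ_η wt η · P(D_η)` for measurable `D`
  (the atoms partition the space, `D ∩ cyl J η = D_η ∩ cyl J η`, and F5 =
  `Independence.setBernoulli_inter_eq_mul_of_disjoint` for `J` and its complement);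
* `sum_wt` — `Σ_η wt η = 1` (the case `D = univ`), and `wt_inf_mul_wt_sup` — the weight is
  log-modular on the lattice `J → Bool` (the hypothesis of Mathlib's `fkg`).

Continued in `HarrisApprox.lean` (Lemma 7.3) and `Harris.lean` (Theorem 7.5, `P7_FKG_holds`).
The auxiliary objects are proof devices local to the P7 modules, not definitions of the route.
-/

namespace Summit.Ventures.PercRepro0.Harris

open MeasureTheory ProbabilityTheory unitInterval Set Defs
open scoped ENNReal NNReal symmDiff

variable {ι : Type*}

/-! ## Patterns on a finite coordinate set -/

section Patch

variable (J : Finset ι)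

/-- The coordinates of `J` switched on by the pattern `η`. -/
def onSet (η : J → Bool) : Set ι := {e | ∃ h : e ∈ J, η ⟨e, h⟩ = true}

/-- Membership in `onSet`. -/
theorem mem_onSet {η : J → Bool} {e : ι} (he : e ∈ J) : e ∈ onSet J η ↔ η ⟨e, he⟩ = true :=
  ⟨fun ⟨_, h⟩ => h, fun h => ⟨he, h⟩⟩

/-- `onSet J η ⊆ J`. -/
theorem onSet_subset (η : J → Bool) : onSet J η ⊆ ↑J := fun _ ⟨h, _⟩ => h

/-- The atom of `F_J` prescribed by `η`: configurations agreeing with `η` on `J`. -/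
def cyl (η : J → Bool) : Set (Set ι) := {ω | ∀ e ∈ J, (e ∈ ω ↔ e ∈ onSet J η)}

/-- Replace the `J`-coordinates of `ω` by the pattern `η`. -/
def patch (η : J → Bool) (ω : Set ι) : Set ι := (ω \ ↑J) ∪ onSet J η

/-- The section of the event `D` along the pattern `η`: `{ω | patch J η ω ∈ D}`. -/
def sect (η : J → Bool) (D : Set (Set ι)) : Set (Set ι) := patch J η ⁻¹' D

/-- On `J`, `patch J η ω` is `η`. -/
theorem mem_patch_of_mem {η : J → Bool} {ω : Set ι} {e : ι} (he : e ∈ J) :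
    e ∈ patch J η ω ↔ e ∈ onSet J η := by
  unfold patch
  constructor
  · rintro (⟨_, hne⟩ | h)
    · exact absurd he hne
    · exact h
  · exact fun h => Or.inr h

/-- Off `J`, `patch J η ω` is `ω`. -/
theorem mem_patch_of_notMem {η : J → Bool} {ω : Set ι} {e : ι} (he : e ∉ J) :
    e ∈ patch J η ω ↔ e ∈ ω := by
  unfold patch
  constructor
  · rintro (⟨h, _⟩ | h)
    · exact h
    · exact absurd (onSet_subset J η h) he
  · exact fun h => Or.inl ⟨h, he⟩

/-- `patch J η ω` lies in the atom of `η`. -/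
theorem patch_mem_cyl (η : J → Bool) (ω : Set ι) : patch J η ω ∈ cyl J η :=
  fun _ he => mem_patch_of_mem J he

/-- On the atom of `η`, patching does nothing. -/
theorem patch_eq_of_mem_cyl {η : J → Bool} {ω : Set ι} (hω : ω ∈ cyl J η) :
    patch J η ω = ω := by
  ext e
  by_cases he : e ∈ J
  · rw [mem_patch_of_mem J he]
    exact (hω e he).symm
  · exact mem_patch_of_notMem J he

/-- Patching is monotone in the pattern. -/
theorem patch_mono {η η' : J → Bool} (h : η ≤ η') (ω : Set ι) :
    patch J η ω ⊆ patch J η' ω := by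
  intro e he'
  by_cases he : e ∈ J
  · rw [mem_patch_of_mem J he, mem_onSet J he] at he' ⊢
    exact Bool.le_iff_imp.1 (h ⟨e, he⟩) he'
  · rw [mem_patch_of_notMem J he] at he' ⊢
    exact he'

/-- Sections of an increasing event are monotone in the pattern. -/
theorem sect_mono_of_isUpperSet {D : Set (Set ι)} (hD : IsUpperSet D) {η η' : J → Bool}
    (h : η ≤ η') : sect J η D ⊆ sect J η' D :=
  fun _ hω => hD (patch_mono J h _) hω

/-- Sections commute with intersections. -/
theorem sect_inter (η : J → Bool) (A B : Set (Set ι)) :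
    sect J η (A ∩ B) = sect J η A ∩ sect J η B := rfl

/-- Distinct patterns have disjoint atoms. -/
theorem cyl_disjoint {η η' : J → Bool} (h : η ≠ η') : Disjoint (cyl J η) (cyl J η') := by
  rw [Set.disjoint_left]
  intro ω hω hω'
  apply h
  funext e
  have h1 : (e : ι) ∈ onSet J η ↔ (e : ι) ∈ onSet J η' := (hω e e.2).symm.trans (hω' e e.2)
  rw [mem_onSet J e.2, mem_onSet J e.2] at h1
  cases hb : η e <;> cases hb' : η' e <;> simp_all

/-- The atoms cover everything. -/
theorem iUnion_cyl : ⋃ η : J → Bool, cyl J η = univ := by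
  classical
  apply eq_univ_of_forall
  intro ω
  refine mem_iUnion.2 ⟨fun e => decide ((e : ι) ∈ ω), fun e he => ?_⟩
  rw [mem_onSet J he]
  simp

/-- The atom of `η` is `F_J`-measurable. -/
theorem measurableSet_cyl (η : J → Bool) :
    MeasurableSet[sigmaOn (↑J : Set ι)] (cyl J η) := by
  have hcyl : cyl J η = ⋂ e : J, {ω : Set ι | (e : ι) ∈ ω ↔ (e : ι) ∈ onSet J η} := by
    ext ω
    simp only [cyl, mem_setOf_eq, mem_iInter, Subtype.forall]
  rw [hcyl]
  refine MeasurableSet.iInter fun e => ?_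
  by_cases h : (e : ι) ∈ onSet J η
  · have : {ω : Set ι | (e : ι) ∈ ω ↔ (e : ι) ∈ onSet J η} = {ω | (e : ι) ∈ ω} := by
      ext ω; simp [h]
    rw [this]
    exact measurableSet_sigmaOn_mem e.2
  · have : {ω : Set ι | (e : ι) ∈ ω ↔ (e : ι) ∈ onSet J η} = {ω | (e : ι) ∈ ω}ᶜ := by
      ext ω; simp [h]
    rw [this]
    exact (measurableSet_sigmaOn_mem e.2).compl

/-- Patching is measurable for the σ-algebra of the coordinates outside `J`. -/
theorem measurable_patch (η : J → Bool) :
    Measurable[sigmaOn (↑J : Set ι)ᶜ] (patch J η) := by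
  rw [@measurable_set_iff ι (Set ι) (sigmaOn (↑J : Set ι)ᶜ) (patch J η)]
  intro e
  by_cases he : e ∈ J
  · have : (fun ω : Set ι => e ∈ patch J η ω) = fun _ => (e ∈ onSet J η) := by
      funext ω
      exact propext (mem_patch_of_mem J he)
    rw [this]
    exact measurable_const
  · have : (fun ω : Set ι => e ∈ patch J η ω) = fun ω => e ∈ ω := by
      funext ω
      exact propext (mem_patch_of_notMem J he)
    rw [this]
    have hle : coordSigma e ≤ sigmaOn (↑J : Set ι)ᶜ :=
      le_iSup₂ (f := fun e (_ : e ∈ (↑J : Set ι)ᶜ) => coordSigma e) e (by simpa using he)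
    exact (comap_measurable _).mono hle le_rfl

/-- Sections of measurable events are measurable for the σ-algebra outside `J`. -/
theorem measurableSet_sect (η : J → Bool) {D : Set (Set ι)} (hD : MeasurableSet D) :
    MeasurableSet[sigmaOn (↑J : Set ι)ᶜ] (sect J η D) :=
  measurable_patch J η hD

end Patch

/-! ## The product weight of an atom and the decomposition over the atoms (Lemma 7.4(b)) -/

section Weight

variable (J : Finset ι) (u : Set ι) (p : I)

/-- The coordinate law of `setBernoulli u p` at `e`: `p·δ_{e ∈ u} + (1 − p)·δ_{False}`. -/
noncomputable abbrev coordLaw (e : ι) : Measure Prop :=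
  toNNReal p • Measure.dirac (e ∈ u) + toNNReal (σ p) • Measure.dirac False

/-- `setBernoulli u p` of an event prescribed coordinatewise on the finite set `J`. -/
theorem setBernoulli_pi (t : ι → Set Prop) :
    setBernoulli u p {ω : Set ι | ∀ e ∈ J, (e ∈ ω) ∈ t e} = ∏ e ∈ J, coordLaw u p e (t e) := by
  rw [setBernoulli_apply']
  have hpre : (fun f : ι → Prop => {i | f i}) ⁻¹' {ω : Set ι | ∀ e ∈ J, (e ∈ ω) ∈ t e}
      = Set.pi (↑J : Set ι) t := by
    ext f
    simp only [mem_preimage, mem_setOf_eq, Set.mem_pi, Finset.mem_coe]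
  rw [hpre, Measure.infinitePi_pi _ (fun _ _ => MeasurableSet.of_discrete)]

/-- The coordinate law of a bond `e ∈ u` on the set `{q | q ↔ X}`. -/
theorem coordLaw_iff {e : ι} (he : e ∈ u) (X : Prop) [Decidable X] :
    coordLaw u p e {q : Prop | q ↔ X} =
      if X then ((toNNReal p : ℝ≥0) : ℝ≥0∞) else ((toNNReal (σ p) : ℝ≥0) : ℝ≥0∞) := by
  simp only [coordLaw, Measure.add_apply, Measure.smul_apply, Measure.dirac_apply]
  by_cases hX : X
  · simp [hX, he]
  · simp [hX, he]

/-- The product weight of the pattern `η` for the constant parameter `p`. -/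
noncomputable def wt (η : J → Bool) : ℝ := ∏ e : J, (if η e = true then (p : ℝ) else 1 - p)

/-- The weights are non-negative. -/
theorem wt_nonneg (η : J → Bool) : 0 ≤ wt J p η :=
  Finset.prod_nonneg fun _ _ => by
    split_ifs
    · exact p.2.1
    · exact sub_nonneg.2 p.2.2

/-- The weight of an atom: `P(cyl J η) = Π_{e ∈ J} p^{η e} (1 − p)^{1 − η e}` for `J ⊆ u`. -/
theorem setBernoulli_cyl (hJ : ↑J ⊆ u) (η : J → Bool) :
    (setBernoulli u p).real (cyl J η) = wt J p η := by
  classical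
  have hc : cyl J η = {ω : Set ι | ∀ e ∈ J, (e ∈ ω) ∈ {q : Prop | q ↔ e ∈ onSet J η}} := by
    ext ω; rfl
  rw [measureReal_def, hc, setBernoulli_pi, ENNReal.toReal_prod]
  have h1 : ∀ e ∈ J, (coordLaw u p e {q : Prop | q ↔ e ∈ onSet J η}).toReal
      = if e ∈ onSet J η then (p : ℝ) else 1 - p := by
    intro e he
    rw [coordLaw_iff u p (hJ he)]
    split_ifs
    · simp
    · simp
  rw [Finset.prod_congr rfl h1, wt, ← Finset.prod_coe_sort J]
  refine Finset.prod_congr rfl fun e _ => ?_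
  have he : (e : ι) ∈ onSet J η ↔ η e = true := mem_onSet J e.2
  simp only [he]

variable [DecidableEq ι]

/-- Lemma 7.4(b) for indicators: `P(D) = Σ_η P(cyl J η) · P(D_η)` for every measurable `D`
(the atoms partition the space; `D_η ∩ cyl J η = D ∩ cyl J η`; F5 for `J` and its complement). -/
theorem real_eq_sum_cyl_mul_sect {D : Set (Set ι)} (hD : MeasurableSet D) :
    (setBernoulli u p).real D =
      ∑ η : J → Bool, (setBernoulli u p).real (cyl J η) * (setBernoulli u p).real (sect J η D) := by
  classical
  have hD' : D = ⋃ η : J → Bool, (sect J η D ∩ cyl J η) := by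
    ext ω
    constructor
    · intro hω
      have hu : ω ∈ ⋃ η : J → Bool, cyl J η := by
        rw [iUnion_cyl]
        exact mem_univ ω
      obtain ⟨η, hη⟩ := mem_iUnion.1 hu
      refine mem_iUnion.2 ⟨η, ?_, hη⟩
      show patch J η ω ∈ D
      rwa [patch_eq_of_mem_cyl J hη]
    · intro hω
      obtain ⟨η, hω1, hη⟩ := mem_iUnion.1 hω
      have : patch J η ω ∈ D := hω1
      rwa [patch_eq_of_mem_cyl J hη] at this
  have key := measureReal_iUnion_fintype (μ := setBernoulli u p)
    (f := fun η : J → Bool => sect J η D ∩ cyl J η)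
    (fun η η' hne => (cyl_disjoint J hne).mono inter_subset_right inter_subset_right)
    (fun η => ((sigmaOn_le _) _ (measurableSet_sect J η hD)).inter
      ((sigmaOn_le _) _ (measurableSet_cyl J η)))
  rw [← hD'] at key
  rw [key]
  refine Finset.sum_congr rfl fun η _ => ?_
  simp only [measureReal_def]
  rw [setBernoulli_inter_eq_mul_of_disjoint u p disjoint_compl_left
    (measurableSet_sect J η hD) (measurableSet_cyl J η), ENNReal.toReal_mul, mul_comm]

/-- Lemma 7.4(b) with the explicit weights: `P(D) = Σ_η w(η) P(D_η)` for `J ⊆ u`. -/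
theorem real_eq_sum_sect (hJ : ↑J ⊆ u) {D : Set (Set ι)} (hD : MeasurableSet D) :
    (setBernoulli u p).real D = ∑ η : J → Bool, wt J p η * (setBernoulli u p).real (sect J η D) := by
  rw [real_eq_sum_cyl_mul_sect J u p hD]
  exact Finset.sum_congr rfl fun η _ => by rw [setBernoulli_cyl J u p hJ η]


/-- `Σ_η wt η = 1`: the decomposition of `univ` over the atoms (`J ⊆ u`). -/
theorem sum_wt (hJ : ↑J ⊆ u) : ∑ η : J → Bool, wt J p η = 1 := by
  have h := real_eq_sum_sect J u p hJ (MeasurableSet.univ (α := Set ι))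
  have hsect : ∀ η : J → Bool, sect J η (univ : Set (Set ι)) = univ := fun _ => preimage_univ
  simp only [hsect, probReal_univ, mul_one] at h
  exact h.symm

omit [DecidableEq ι] in
/-- The weight is log-modular (in fact multiplicative) on the lattice `J → Bool`:
`wt (a ⊓ b) · wt (a ⊔ b) = wt a · wt b`. -/
theorem wt_inf_mul_wt_sup (a b : J → Bool) :
    wt J p (a ⊓ b) * wt J p (a ⊔ b) = wt J p a * wt J p b := by
  unfold wt
  rw [← Finset.prod_mul_distrib, ← Finset.prod_mul_distrib]
  refine Finset.prod_congr rfl fun i _ => ?_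
  simp only [Pi.inf_apply, Pi.sup_apply]
  rcases Bool.eq_false_or_eq_true (a i) with ha | ha <;>
    rcases Bool.eq_false_or_eq_true (b i) with hb | hb <;> simp [ha, hb, mul_comm]

end Weight

end Summit.Ventures.PercRepro0.Harris
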